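import Literature.NumberTheory.LFunctions.Zhang2022.DetectorClassDETShift
import Literature.NumberTheory.LFunctions.Zhang2022.RepairDetShift

/-!
# Zhang (2022) §18-margin repair rung, barrier extension (cell landau-siegel §E; the «p6 wrap of (u1)» of the B-det
# intake): the DISCRETE-LEVEL detector families — (a)-members of class DET with ANY configuration-valid endgame,
# positivity DISPLAYED; and the sign-admissible shift detectors at the discrete level GIVEN Prop. 2.2 only

Y. Zhang, *Discrete mean estimates and the Landau–Siegel zero*, arXiv:2211.02515v1 (2022) [Zhang2022LandauSiegel] —
an unrefereed manuscript under adjudication. **WHAT THIS IS NOT: a claim about its Theorems 1–2, about Landau–Siegel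
zeros, about Parity, or about a repaired `Margin232`. The programme SEARCHES and TYPES; no claim about Landau–Siegel
zeros, Theorems 1–2 of arXiv:2211.02515 or a repaired Margin232 until a kernel theorem says so.**

## What is wrapped (nothing re-proved; two `Repair.DesignFamily` rows over landed detector-level theorems)

The B-det intake (`RepairIntakeBdet`, item (u1)) records: «(a)-members with GENERAL weights `(P₀, P₁, e, a)` beyond the
shift-detector shape … at the DISCRETE level their configuration-valid endgames hold exactly GIVEN Prop 2.2 and the
displayed (a)-membership (`DetTemplate.Detector.Positive.endgame_nonneg`, `Det.ConfigValid.mainOrder_nonneg`, …;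
for shift data `Det.shiftDesign` / `positive_detector_shiftDesign_of_signAdmissible`) — detector-level theorems, no
`Repair.DesignFamily` wrap landed (owner ls-barrier-p6)». This file lands the wrap, in the extension protocol of
`RepairRplus` (every conditional input DISPLAYED in `Verdict`, nothing analytic in `InClass`):

* **`Repair.familyDetPositive`** — designs `(k; d : Det.DETDesign k; c′; r; Φ)`: ANY member of class DET (`k` shifts in the
  Part-III box, weight polynomials `P₀, P₁` of total degree `≤ 3`, constant phase, sampling `Σ₁/Σ₂`, family `Ψ₁/Ψ`,
  amplifier `a ≥ 0`: `DetectorClassDET`) with the manuscript's constant `c′` and ANY endgame functional `Φ` on `r` test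
  families. Class predicate: `Det.ConfigValid Φ` (the endgame is a universally valid inequality among the displayed means —
  Cauchy–Schwarz, POS, Gram minors, Turán-type, …: `DetectorEndgameValidity`; an endgame that is not configuration-valid
  is OUTSIDE DET by the class text (iv)). Verdict: **(a)-membership DISPLAYED** — `(d.detector c′).Positive` (the
  generalised Lemma 2.3: weights real and `≥ 0` at every sampled pair, for all large `D`; registry E-086 / E-det-2, read
  off the member's own lattice symbol) `→ ForAllLarge (∀ test families u, ¬ (Φ (gram u) < 0))`: the endgame never closes,
  at every stage, EXACTLY (`DetTemplate.Detector.Positive.endgame_nonneg`, p464106/p464704). Currency (C3(e)): the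
  DISCRETE means themselves (`DetTemplate.Detector.gram`) — no main-term calculus, no (A)-world evaluation; (b)-members
  (sign-indefinite weights) are outside: `Det.not_cauchySchwarz_signed`.
* **`Repair.familyDetShiftDiscrete`** — designs `(b; c′; r; Φ)`: the SIGN-ADMISSIBLE three-shift detector
  (`Det.SignAdmissible b`, Part-III box `Det.InShiftBox b`, canonical corrections `e = (−1, 1, −1)`, `c′ ≥ 0` — the W1 ∪ W2
  members of the word, `Det.shiftDesign`) with any configuration-valid endgame; verdict **GIVEN Prop. 2.2 ONLY**
  (`Skeleton.Prop22 c′`, the manuscript's own zero-spacing proposition, DISPLAYED) `→` no closing at any stage — the sign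
  input is then a theorem (`Det.positive_detector_shiftDesign_of_signAdmissible`, E-086 discharged for the printed
  perturbation pattern, p466135). At `b = (1,2,3)` the member is the manuscript's own detector (`Det.shiftDesign_zhangShift`).
* `familyDetPositive_decided`, `familyDetShiftDiscrete_decided`, `rplus_detPositive_decided`, `rplus_detShiftDiscrete_decided`,
  `rplus_detDiscrete_both_decided`; the embedding `detShiftDiscrete_toPositive` (a W2 member is a DET member whose displayed
  positivity is discharged by Prop. 2.2) and the Cauchy–Schwarz instance `detShiftDiscrete_cs_verdict` (the §2 endgame
  shape `¬ (Re Ξ(u,u)·Re Ξ(v,v) − |Ξ(u,v)|² < 0)`, `Det.configValid_cauchySchwarz`).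

Relation to rows 17/55 (main-term level, one-sided legs) and 56/57 (glued legs): those decide the CONTINUED MAIN-TERM
calculus of the detector (formula I / the dictionary); these decide the DISCRETE means before any evaluation — the two
readings (B1)/(B2) of the intake's clause (iv). Nothing here is a statement about zeros: `Positive` and `Prop22` are
displayed, never asserted. Elementary assembly; no numerics; no new `Prop` facts; standard axioms.

References: Y. Zhang, arXiv:2211.02515v1 (2022), §2 (2.13)–(2.19), Prop. 2.2, Lemma 2.3 and its proof, Props. 2.4–2.6,
(2.32)–(2.34) [pp. 4–6, 10–12]. [cite: Zhang2022LandauSiegel, §2]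
-/

noncomputable section

open Complex

namespace Literature.NumberTheory.LFunctions.Zhang2022

namespace Repair

open Det DetTemplate Skeleton

/-! ### Family P: (a)-members of class DET with a configuration-valid endgame, positivity displayed -/

/-- **A discrete-level DET design with its endgame**: `k` shifts, a class-DET member `d` (`Det.DETDesign k`), the
manuscript's constant `c′` of (2.13), and an endgame functional `Φ` on the Gram array of `r` test families.
[cite: Zhang2022LandauSiegel, §2 (2.13)–(2.19)] -/
structure DetPositiveDesign where
  /-- number of shifts -/
  k : ℕ
  /-- the class-DET member (shifts, weight polynomials, phase, sampling, family, amplifier) -/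
  d : DETDesign k
  /-- the constant `c′` of (2.13) -/
  c' : ℝ
  /-- number of test families entering the endgame -/
  r : ℕ
  /-- the endgame functional on the `r × r` Gram array of discrete means -/
  Φ : GramData r → ℝ

namespace DetPositiveDesign

/-- **Class membership** (structural only): the endgame `Φ` is CONFIGURATION-VALID (`Det.ConfigValid`: `≥ 0` on the Gram
array of every finite non-negatively weighted configuration — CS, POS, Gram minors, Turán-type, …; clause (iv) of the class
text). [cite: Zhang2022LandauSiegel, §2 (2.18)–(2.19), (2.34)] -/
def InClass (p : DetPositiveDesign) : Prop := ConfigValid p.Φ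

/-- **The verdict, (a)-membership displayed**: IF the member's detector is `Positive` (generalised Lemma 2.3: weights real,
`≥ 0` at every sampled pair, for all large `D`) THEN for all large `D` and every real primitive `χ`, for every choice of the
`r` test families on the sampled pairs, the endgame does not close: `¬ (Φ (gram) < 0)`.
[cite: Zhang2022LandauSiegel, §2 (2.16)–(2.19), Lemma 2.3, (2.34)] -/
def Verdict (p : DetPositiveDesign) : Prop :=
  (p.d.detector p.c').Positive →
    ForAllLarge fun D _ χ => ∀ u : Fin p.r → (_ : Chr D) × ℂ → ℂ, ¬ (p.Φ ((p.d.detector p.c').gram χ u) < 0)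

end DetPositiveDesign

/-- **NO (a)-MEMBER OF DET CLOSES A CONFIGURATION-VALID ENDGAME AT THE DISCRETE LEVEL (positivity displayed)** —
`DetTemplate.Detector.Positive.endgame_nonneg` packaged: exact, every stage, no main-term calculus.
[cite: Zhang2022LandauSiegel, §2 (2.16)–(2.19), Lemma 2.3, (2.34)] -/
theorem not_repairable_detPositive : ∀ p : DetPositiveDesign, p.InClass → p.Verdict :=
  fun _ hΦ hpos => (hpos.endgame_nonneg hΦ).mono fun _ _ _ _ _ h u => not_lt.2 (h u)

/-- family «class DET (a)-members, any configuration-valid endgame, DISCRETE currency» (positivity displayed in the verdict).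
[cite: Zhang2022LandauSiegel, §2 (2.16)–(2.19), Lemma 2.3] -/
def familyDetPositive : DesignFamily where
  Design := DetPositiveDesign
  InClass := DetPositiveDesign.InClass
  Verdict := DetPositiveDesign.Verdict

/-- `familyDetPositive` is decided. [cite: Zhang2022LandauSiegel, §2 (2.16)–(2.19)] -/
theorem familyDetPositive_decided : familyDetPositive.Decided := not_repairable_detPositive

/-- `R⁺ ++ [familyDetPositive]` is decided. [cite: Zhang2022LandauSiegel, §2 (2.16)–(2.19)] -/
theorem rplus_detPositive_decided : ClassDecided (Rplus ++ [familyDetPositive]) :=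
  rplus_extend familyDetPositive_decided

/-! ### Family S: the sign-admissible shift detectors at the discrete level, GIVEN Prop. 2.2 only -/

/-- **A discrete-level shift-detector design with its endgame**: a shift triple `b`, the constant `c′`, and an endgame `Φ`
on `r` test families (the detector is `Det.shiftDesign ⟨b, (−1,1,−1)⟩`: weight `−iΠ_jM(ρ+β_j)/M′(ρ)·ω(ρ)` on `𝔷(ψ)`, `Ψ₁`).
[cite: Zhang2022LandauSiegel, §2 (2.13)–(2.16), Lemma 2.3] -/
structure DetShiftDiscreteDesign : Type where
  /-- shift multiples `b = (b₀; b₁, b₂)` -/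
  b : Fin 3 → ℝ
  /-- the constant `c′` of (2.13) -/
  c' : ℝ
  /-- number of test families -/
  r : ℕ
  /-- the endgame functional -/
  Φ : GramData r → ℝ

namespace DetShiftDiscreteDesign

/-- **Class membership** (structural only): `b` sign-admissible (`Det.SignAdmissible`, the Lemma-2.3 shape) and in the
Part-III box (`Det.InShiftBox`), `c′ ≥ 0`, endgame configuration-valid. [cite: Zhang2022LandauSiegel, §2 (2.13), Lemma 2.3, (2.18)–(2.19)] -/
def InClass (p : DetShiftDiscreteDesign) : Prop :=
  SignAdmissible p.b ∧ InShiftBox p.b ∧ 0 ≤ p.c' ∧ ConfigValid p.Φ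

/-- **The verdict GIVEN Prop. 2.2 only** (`Skeleton.Prop22 c′` DISPLAYED — the manuscript's zero-spacing proposition, from
which the member's sign input follows: `Det.positive_detector_shiftDesign_of_signAdmissible`): for the W2 member with shifts
`b` (any proof of the box condition), for all large `D`, every `χ`, every test families, `¬ (Φ (gram) < 0)`.
[cite: Zhang2022LandauSiegel, §2 Prop. 2.2, Lemma 2.3, (2.16)–(2.19), (2.34)] -/
def Verdict (p : DetShiftDiscreteDesign) : Prop :=
  ∀ hbox : InShiftBox p.b, Skeleton.Prop22 p.c' →
    ForAllLarge fun D _ χ => ∀ u : Fin p.r → (_ : Chr D) × ℂ → ℂ,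
      ¬ (p.Φ (((shiftDesign ⟨p.b, ![-1, 1, -1]⟩ hbox).detector p.c').gram χ u) < 0)

end DetShiftDiscreteDesign

/-- **NO SIGN-ADMISSIBLE SHIFT DETECTOR CLOSES A CONFIGURATION-VALID ENDGAME AT THE DISCRETE LEVEL, GIVEN Prop. 2.2** —
the displayed positivity of `familyDetPositive` is discharged on this sub-class by the manuscript's own Prop. 2.2
(`Det.positive_detector_shiftDesign_of_signAdmissible`). [cite: Zhang2022LandauSiegel, §2 Prop. 2.2, Lemma 2.3, (2.16)–(2.19)] -/
theorem not_repairable_detShiftDiscrete : ∀ p : DetShiftDiscreteDesign, p.InClass → p.Verdict :=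
  fun p ⟨hb, _, hc, hΦ⟩ hbox h22 =>
    not_repairable_detPositive ⟨3, shiftDesign ⟨p.b, ![-1, 1, -1]⟩ hbox, p.c', p.r, p.Φ⟩ hΦ
      (positive_detector_shiftDesign_of_signAdmissible hb hbox hc h22)

/-- family «sign-admissible shift detector, DISCRETE currency, GIVEN Prop. 2.2» (Prop. 2.2 displayed in the verdict).
[cite: Zhang2022LandauSiegel, §2 Prop. 2.2, Lemma 2.3, (2.16)–(2.19)] -/
def familyDetShiftDiscrete : DesignFamily where
  Design := DetShiftDiscreteDesign
  InClass := DetShiftDiscreteDesign.InClass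
  Verdict := DetShiftDiscreteDesign.Verdict

/-- `familyDetShiftDiscrete` is decided. [cite: Zhang2022LandauSiegel, §2 (2.16)–(2.19)] -/
theorem familyDetShiftDiscrete_decided : familyDetShiftDiscrete.Decided := not_repairable_detShiftDiscrete

/-- `R⁺ ++ [familyDetShiftDiscrete]` is decided. [cite: Zhang2022LandauSiegel, §2 (2.16)–(2.19)] -/
theorem rplus_detShiftDiscrete_decided : ClassDecided (Rplus ++ [familyDetShiftDiscrete]) :=
  rplus_extend familyDetShiftDiscrete_decided

/-- Both discrete-level rows at once. [cite: Zhang2022LandauSiegel, §2 (2.16)–(2.19)] -/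
theorem rplus_detDiscrete_both_decided : ClassDecided (Rplus ++ [familyDetPositive, familyDetShiftDiscrete]) :=
  classDecided_append.2 ⟨rplus_decided,
    classDecided_cons familyDetPositive_decided (classDecided_cons familyDetShiftDiscrete_decided classDecided_nil)⟩

/-! ### Dictionary between the two rows and the §2 Cauchy–Schwarz shape -/

/-- **A shift-detector member is a DET member** (same detector, same endgame); its displayed positivity is discharged by
Prop. 2.2 on the class. [cite: Zhang2022LandauSiegel, §2 Prop. 2.2, Lemma 2.3] -/
def DetShiftDiscreteDesign.toPositive (p : DetShiftDiscreteDesign) (hbox : InShiftBox p.b) : DetPositiveDesign :=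
  ⟨3, shiftDesign ⟨p.b, ![-1, 1, -1]⟩ hbox, p.c', p.r, p.Φ⟩

/-- The embedding preserves the class and, GIVEN Prop. 2.2, discharges the displayed positivity.
[cite: Zhang2022LandauSiegel, §2 Prop. 2.2, Lemma 2.3] -/
theorem detShiftDiscrete_toPositive (p : DetShiftDiscreteDesign) (h : p.InClass) (hbox : InShiftBox p.b) :
    (p.toPositive hbox).InClass ∧ (Skeleton.Prop22 p.c' → ((p.toPositive hbox).d.detector p.c').Positive) :=
  ⟨h.2.2.2, fun h22 => positive_detector_shiftDesign_of_signAdmissible h.1 hbox h.2.2.1 h22⟩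

/-- **The §2 endgame shape on two test families** (`r = 2`, `Φ = csEndgame 0 1`:
`Re Ξ(u,u)·Re Ξ(v,v) − |Ξ(u,v)|²`): for a sign-admissible shift detector, GIVEN Prop. 2.2, the Cauchy–Schwarz closing
inequality `Ξ(u,u)Ξ(v,v) < |Ξ(u,v)|²` NEVER holds on its discrete means, at any stage (`Det.configValid_cauchySchwarz`).
[cite: Zhang2022LandauSiegel, §2 (2.18)–(2.19), (2.34)] -/
theorem detShiftDiscrete_cs_verdict {b : Fin 3 → ℝ} (hb : SignAdmissible b) (hbox : InShiftBox b) {c' : ℝ}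
    (hc : 0 ≤ c') (h22 : Skeleton.Prop22 c') :
    ForAllLarge fun D _ χ => ∀ u : Fin 2 → (_ : Chr D) × ℂ → ℂ,
      ¬ (csEndgame 0 1 (((shiftDesign ⟨b, ![-1, 1, -1]⟩ hbox).detector c').gram χ u) < 0) :=
  not_repairable_detShiftDiscrete ⟨b, c', 2, csEndgame 0 1⟩ ⟨hb, hbox, hc, configValid_cauchySchwarz 0 1⟩ hbox h22

/-- At the printed data `b = (1,2,3)` the member is the manuscript's own detector design (`Det.zhangDesign`) when the
corrections are the printed ones; with the canonical `e = (−1,1,−1)` it is the main-values form of the same detector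
(`Det.shiftDesign`; both `Positive` given Prop. 2.2). [cite: Zhang2022LandauSiegel, §2 (2.13)–(2.16)] -/
theorem detShiftDiscrete_std_inClass {c' : ℝ} (hc : 0 ≤ c') {r : ℕ} {Φ : GramData r → ℝ} (hΦ : ConfigValid Φ) :
    (⟨![1, 2, 3], c', r, Φ⟩ : DetShiftDiscreteDesign).InClass :=
  ⟨signAdmissible_std, inShiftBox_std, hc, hΦ⟩

end Repair

end Literature.NumberTheory.LFunctions.Zhang2022
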